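/-
Copyright (c) 2026 the pub-hodgecm-mathlib formalisation cell (harness21).  Prover seat hodgecm-mathlib-K2E3-p25 (g3) (L4 architect), HCML Track B «K2-LIT» ∕ h413
(`stmt-HodgeConjecture-24833`).  NR-1′ «LeThree SWEEP» (director s1979∕s1980): the hHC∕hHCB-binding theorems of ★ `F0P3cStCharTSHcbH` RE-READ under the NARROWED letters
hHC₃ `characterLocallyIntegrableLeThree` ∕ hHCB₃ `normalizedCharacter_locallyBoundedLeThree` (`2 ≤ N ≤ 3`, `v` non-split) — SAME NAMES, namespace `…K2E3HcbHLeThree`.  2026-09-04.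
-/
import Summits.HodgeConjecture.HodgeConjecture.Theorems.F0P3cStCharTSDGFieldTwo       -- ★ p851405 (this seat) «DG-FIELD★» at `N = 2`: `exists_unit_rel_iff_isUnit_discr_two` (the HC antecedent ↔ unit discriminant); brings ★ DGField §0
import Literature.NumberTheory.Rogawski1990.Ch12Sec7CharacterInputs                    -- ★ p850727 the NAMED FACT (HC-B) `normalizedCharacter_locallyBounded` [HarishChandra1999AdmissibleDistributions Thm. 16.3]
import Literature.NumberTheory.Rogawski1990.Ch12Sec5Defs                              -- ★ TR dictionary: `EllipticData` (fields `DH`, `charH`, `cartanH`, `sqPacketsH`; `packetCharH`)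
import HarnessLib
import Summits.HodgeConjecture.HodgeConjecture.Theorems.F0P3cStCharTSHcbH   -- ★ the original: every non-letter lemma REUSED by qualified name
import Summits.HodgeConjecture.HodgeConjecture.Theorems.K2E3CharLettersLeThreeDefs   -- NR-1′ root: hHC₃ ∕ hHCB₃

/-!
# NR-1′ twin — ★ `F0P3cStCharTSHcbH` under the narrowed Harish-Chandra letters (`2 ≤ N ≤ 3`, `v` non-split)

Cell `pub/hodgecm-mathlib`, crux H413 = `stmt-HodgeConjecture-24833`, line L4 `stub_StCharTS`; director rulings NR-1′ (s1979) ∕ «GO — LeThree SWEEP» (s1980); architect memo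
`K2/K2E3-p25/g3/NR1-narrowing-cone.K2E3-p25-g3.md`.  THEOREMS ONLY; count-neutral helper (`--supports stmt-HodgeConjecture-24833 --as helper`).  Exactly the theorems of the
original ★ file whose statements bind `Ch1.characterLocallyIntegrable` ∕ `normalizedCharacter_locallyBounded`, copied with the binder TYPE replaced by hHC₃ ∕ hHCB₃
(★ `K2E3CharLettersLeThreeDefs`), the rank∕non-split arguments supplied at each application (`2 ≤ N`, `N ≤ 3` by `norm_num`; the organ's `∀ w ∣ v, conj • w = w`), an added `hns`
binder where the original head was place-agnostic, and calls into other cone files re-pointed to their twins; every other lemma of the original is used BY QUALIFIED NAME.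
No new mathematics.  The original ★ declarations are untouched.

HONEST LABEL: HC_CM is proved only modulo the 7 printed citations (2 remaining named inputs: hLiu418 = `stmt-HodgeConjecture-24832`, h413 = `stmt-HodgeConjecture-24833`) until rung 0
closes; count-neutral; CONDITIONAL on the narrowed letters (stated, not assumed).

## References
* [Rogawski1990] J. D. Rogawski, *Automorphic Representations of Unitary Groups in Three Variables* (1990), §1.6 p. 5; §4.9 p. 54; §12.5–12.7.
* [HarishChandra1999AdmissibleDistributions] Harish-Chandra, *Admissible Invariant Distributions on Reductive p-adic Groups*, ULS 16 (1999), Thm. 16.3.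
-/

set_option autoImplicit false
-- the mandated namespace has the single-problem summit's repeated segment (`HodgeConjecture.HodgeConjecture`)
set_option linter.dupNamespace false

noncomputable section

open MeasureTheory Filter Topology
open NumberField IsDedekindDomain
open scoped NNReal Matrix MatrixGroups
open Literature.NumberTheory.Automorphic Literature.NumberTheory.Automorphic.UnitaryGroup
open Literature.NumberTheory.Rogawski1990 Literature.NumberTheory.Rogawski1990.Ch12Sec5

open Summit.HodgeConjecture.HodgeConjecture.Cruxes.H413.K2E3CharLettersLeThreeDefs

namespace Summit.HodgeConjecture.HodgeConjecture.Cruxes.H413.K2E3HcbHLeThree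

variable (L : Type) [Field L] [NumberField L] [IsCMField L] (v : HeightOneSpectrum (𝓞 ↥(maximalRealSubfield L)))

/-! ## §1 The bound on a compact subset of `U(J)(L⁺_v) × G₁` from (HC-B) at `N = 2` -/

/-- **«HCB-H★» — `|D_H(s)·(Θ₂ ⊠ χ₁)(s)| ≤ B` on every compact `C ⊆ U(J)(L⁺_v) × G₁`.**  `J` a non-degenerate Hermitian `2 × 2` form over the CM field `L`, `v` a finite place of `L⁺`,
`G₂ = U(J)(L⁺_v)` with a Haar measure `μ₂`; `Θ₂` a Harish-Chandra character function of a class `σ₂` of `G₂` (locally integrable, locally constant at the regular points, representing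
`Tr σ₂` — the antecedents of ★ `normalizedCharacter_locallyBoundedLeThree`); `G₁` any topological space with a continuous `χ₁ : G₁ → ℂ`; `DG₂` any function with the two letters of ★
`exists_DG_field_two` (`= 0` at a non-unit discriminant, `= √√‖u‖` at the HC antecedent `u·det(γ)^(2−1) = discr(charpoly γ)`); `D_H = DG₂ ∘ pr₁` and `Θ = Θ₂ ⊠ χ₁` as equations.
THEN, GIVEN (HC-B) `hHC`, every compact `C ⊆ G₂ × G₁` carries a bound `‖D_H(s)·Θ(s)‖ ≤ B`. [cite: Rogawski1990, §1.6 p. 6; §4.9 pp. 54–55; §12.7 Lemma 12.7.2 (proof) p. 193]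
[cite: HarishChandra1999AdmissibleDistributions, Part III §16 Thm. 16.3] -/
theorem exists_bound_DH_mul_of_boxChar (hHC : normalizedCharacter_locallyBoundedLeThree)
    (hns : ∀ w : PlacesOver L v, IsCMField.complexConj L • w.1 = w.1)
    (J : Matrix (Fin 2) (Fin 2) L) (hJ : (J.map (cmConjRingHom L))ᵀ = J) (hJd : J.det ≠ 0)
    [MeasurableSpace ((UnitaryGroup.cmDatum L 2 J).Local v)] [BorelSpace ((UnitaryGroup.cmDatum L 2 J).Local v)]
    (μ₂ : Measure ((UnitaryGroup.cmDatum L 2 J).Local v)) [μ₂.IsHaarMeasure]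
    (σ₂ : IrrClass ((UnitaryGroup.cmDatum L 2 J).Local v)) (Θ₂ : (UnitaryGroup.cmDatum L 2 J).Local v → ℂ)
    (hli : LocallyIntegrable Θ₂ μ₂)
    (hlc : ∀ x : (UnitaryGroup.cmDatum L 2 J).Local v, IsRegularElt (x.val : GL (Fin 2) (UnitaryGroup.LocalRing L v)) → ∀ᶠ y in 𝓝 x, Θ₂ y = Θ₂ x)
    (htr : ∀ φ : (UnitaryGroup.cmDatum L 2 J).Local v → ℂ, IsLocSmooth φ → σ₂.smoothTrace μ₂ φ = ∫ x, φ x * Θ₂ x ∂μ₂)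
    {G₁ : Type} [TopologicalSpace G₁] (χ₁ : G₁ → ℂ) (hχ₁ : Continuous χ₁)
    (DG₂ : (UnitaryGroup.cmDatum L 2 J).Local v → ℝ)
    (hDG₂0 : ∀ γ : (UnitaryGroup.cmDatum L 2 J).Local v, ¬ IsUnit ((γ.val.val.charpoly).discr) → DG₂ γ = 0)
    (hDG₂rel : ∀ (γ : (UnitaryGroup.cmDatum L 2 J).Local v) (u : (UnitaryGroup.LocalRing L v)ˣ),
      (u : UnitaryGroup.LocalRing L v) * (γ.val.val.det) ^ (2 - 1) = (γ.val.val.charpoly).discr →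
        DG₂ γ = ((NNReal.sqrt (NNReal.sqrt (unitModulusChar (UnitaryGroup.LocalRing L v) u)) : ℝ≥0) : ℝ))
    (DH : (UnitaryGroup.cmDatum L 2 J).Local v × G₁ → ℝ) (hDH : ∀ h, DH h = DG₂ h.1)
    (Θ : (UnitaryGroup.cmDatum L 2 J).Local v × G₁ → ℂ) (hΘ : ∀ h, Θ h = Θ₂ h.1 * χ₁ h.2)
    (C : Set ((UnitaryGroup.cmDatum L 2 J).Local v × G₁)) (hC : IsCompact C) :
    ∃ B : ℝ, ∀ s ∈ C, ‖(DH s : ℂ) * Θ s‖ ≤ B := by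
  -- (HC-B) at `N = 2` on the compact first projection
  obtain ⟨B₂, hB₂⟩ := hHC L 2 (by norm_num) (by norm_num) J hJ hJd v hns μ₂ σ₂ Θ₂ hli hlc htr (Prod.fst '' C) (hC.image continuous_fst)
  -- `χ₁` is bounded on the compact second projection
  obtain ⟨M, hM⟩ := (hC.image continuous_snd).exists_bound_of_continuousOn (f := χ₁) hχ₁.continuousOn
  refine ⟨max B₂ 0 * max M 0, fun s hs => ?_⟩
  have h1 : s.1 ∈ Prod.fst '' C := Set.mem_image_of_mem _ hs
  have h2 : ‖χ₁ s.2‖ ≤ max M 0 := (hM s.2 (Set.mem_image_of_mem _ hs)).trans (le_max_left _ _)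
  rw [hDH s, hΘ s, ← mul_assoc, norm_mul]
  refine mul_le_mul ?_ h2 (norm_nonneg _) (le_max_of_le_right le_rfl)
  -- the `U(J)` factor: regular (HC antecedent inhabited) or singular (`DG₂ = 0`)
  by_cases hreg : IsUnit ((s.1.val.val.charpoly).discr)
  · obtain ⟨u, hu⟩ := (F0P3cStCharTSDGFieldTwo.exists_unit_rel_iff_isUnit_discr_two L v J s.1).2 hreg
    rw [norm_mul, Complex.norm_real, Real.norm_eq_abs, hDG₂rel s.1 u hu, abs_of_nonneg (NNReal.coe_nonneg _)]
    exact (hB₂ s.1 h1 u hu).trans (le_max_left _ _)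
  · rw [hDG₂0 s.1 hreg, Complex.ofReal_zero, zero_mul, norm_zero]
    exact le_max_right _ _

/-! ## §2 At a datum (GENERIC carriers): the `hHBH` texts of ★ S13a∕S13c and ★ S12a from ONE compact-set bound for `χ_{St_H}` and `hSq` -/

section Generic

variable {G H : Type} [Group G] [TopologicalSpace G] [IsTopologicalGroup G] [MeasurableSpace G]
  [∀ γ : G, MeasurableSpace (G ⧸ Subgroup.centralizer ({γ} : Set G))] [MeasurableSpace (G ⧸ Subgroup.center G)]
  [Group H] [TopologicalSpace H] [IsTopologicalGroup H] [MeasurableSpace H]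

end Generic

/-! ## §3 The compact-set bound at a datum on `U(J)(L⁺_v) × G₁` with the (B) «H-FIELDS» field equations `D_H = DG₂ ∘ pr₁`, `χ_{St_H} = Θ₂ ⊠ χ₁` — and the two `hHBH` texts from them -/

section Datum

variable {G : Type} [Group G] [TopologicalSpace G] [IsTopologicalGroup G] [MeasurableSpace G]
  [∀ γ : G, MeasurableSpace (G ⧸ Subgroup.centralizer ({γ} : Set G))] [MeasurableSpace (G ⧸ Subgroup.center G)]

/-- **The compact-set bound for `𝔇.charH πSt` on every compact `C ⊆ H`** at a datum `𝔇 : EllipticData G (U(J)(L⁺_v) × G₁)` whose `DH` and `charH πSt` satisfy the (B) «H-FIELDS»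
field equations `DH = DG₂ ∘ pr₁` (`DG₂` with the two letters of ★ `exists_DG_field_two`) and `charH πSt = Θ₂ ⊠ χ₁` (§1).  This is the (HCB-H) clause the `H`-fields witness can export.
[cite: Rogawski1990, §1.6 p. 6; §12.5 p. 184] [cite: HarishChandra1999AdmissibleDistributions, Part III §16 Thm. 16.3] -/
theorem compactBound_charH_of_boxChar (hHC : normalizedCharacter_locallyBoundedLeThree)
    (hns : ∀ w : PlacesOver L v, IsCMField.complexConj L • w.1 = w.1)
    (J : Matrix (Fin 2) (Fin 2) L) (hJ : (J.map (cmConjRingHom L))ᵀ = J) (hJd : J.det ≠ 0)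
    [MeasurableSpace ((UnitaryGroup.cmDatum L 2 J).Local v)] [BorelSpace ((UnitaryGroup.cmDatum L 2 J).Local v)]
    (μ₂ : Measure ((UnitaryGroup.cmDatum L 2 J).Local v)) [μ₂.IsHaarMeasure]
    (σ₂ : IrrClass ((UnitaryGroup.cmDatum L 2 J).Local v)) (Θ₂ : (UnitaryGroup.cmDatum L 2 J).Local v → ℂ)
    (hli : LocallyIntegrable Θ₂ μ₂)
    (hlc : ∀ x : (UnitaryGroup.cmDatum L 2 J).Local v, IsRegularElt (x.val : GL (Fin 2) (UnitaryGroup.LocalRing L v)) → ∀ᶠ y in 𝓝 x, Θ₂ y = Θ₂ x)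
    (htr : ∀ φ : (UnitaryGroup.cmDatum L 2 J).Local v → ℂ, IsLocSmooth φ → σ₂.smoothTrace μ₂ φ = ∫ x, φ x * Θ₂ x ∂μ₂)
    {G₁ : Type} [Group G₁] [TopologicalSpace G₁] [IsTopologicalGroup G₁] [MeasurableSpace (((UnitaryGroup.cmDatum L 2 J).Local v) × G₁)]
    (χ₁ : G₁ → ℂ) (hχ₁ : Continuous χ₁)
    (DG₂ : (UnitaryGroup.cmDatum L 2 J).Local v → ℝ)
    (hDG₂0 : ∀ γ : (UnitaryGroup.cmDatum L 2 J).Local v, ¬ IsUnit ((γ.val.val.charpoly).discr) → DG₂ γ = 0)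
    (hDG₂rel : ∀ (γ : (UnitaryGroup.cmDatum L 2 J).Local v) (u : (UnitaryGroup.LocalRing L v)ˣ),
      (u : UnitaryGroup.LocalRing L v) * (γ.val.val.det) ^ (2 - 1) = (γ.val.val.charpoly).discr →
        DG₂ γ = ((NNReal.sqrt (NNReal.sqrt (unitModulusChar (UnitaryGroup.LocalRing L v) u)) : ℝ≥0) : ℝ))
    (𝔇 : EllipticData G (((UnitaryGroup.cmDatum L 2 J).Local v) × G₁)) (πSt : IrrClass (((UnitaryGroup.cmDatum L 2 J).Local v) × G₁))
    (hDHf : ∀ h, 𝔇.DH h = DG₂ h.1) (hcharSt : ∀ h, 𝔇.charH πSt h = Θ₂ h.1 * χ₁ h.2) :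
    ∀ C : Set (((UnitaryGroup.cmDatum L 2 J).Local v) × G₁), IsCompact C → ∃ B : ℝ, ∀ s ∈ C, ‖(𝔇.DH s : ℂ) * 𝔇.charH πSt s‖ ≤ B :=
  fun C hC => exists_bound_DH_mul_of_boxChar L v hHC hns J hJ hJd μ₂ σ₂ Θ₂ hli hlc htr χ₁ hχ₁ DG₂ hDG₂0 hDG₂rel 𝔇.DH hDHf (𝔇.charH πSt) hcharSt C hC

/-- **S13a∕S13c's `hHBH` as a theorem of the field equations** (+ `hSq`): §3's bound through §2. [cite: Rogawski1990, §1.6 p. 6; §12.7 Lemma 12.7.2 (proof) p. 193]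
[cite: HarishChandra1999AdmissibleDistributions, Part III §16 Thm. 16.3] -/
theorem hHBH_of_boxChar (hHC : normalizedCharacter_locallyBoundedLeThree)
    (hns : ∀ w : PlacesOver L v, IsCMField.complexConj L • w.1 = w.1)
    (J : Matrix (Fin 2) (Fin 2) L) (hJ : (J.map (cmConjRingHom L))ᵀ = J) (hJd : J.det ≠ 0)
    [MeasurableSpace ((UnitaryGroup.cmDatum L 2 J).Local v)] [BorelSpace ((UnitaryGroup.cmDatum L 2 J).Local v)]
    (μ₂ : Measure ((UnitaryGroup.cmDatum L 2 J).Local v)) [μ₂.IsHaarMeasure]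
    (σ₂ : IrrClass ((UnitaryGroup.cmDatum L 2 J).Local v)) (Θ₂ : (UnitaryGroup.cmDatum L 2 J).Local v → ℂ)
    (hli : LocallyIntegrable Θ₂ μ₂)
    (hlc : ∀ x : (UnitaryGroup.cmDatum L 2 J).Local v, IsRegularElt (x.val : GL (Fin 2) (UnitaryGroup.LocalRing L v)) → ∀ᶠ y in 𝓝 x, Θ₂ y = Θ₂ x)
    (htr : ∀ φ : (UnitaryGroup.cmDatum L 2 J).Local v → ℂ, IsLocSmooth φ → σ₂.smoothTrace μ₂ φ = ∫ x, φ x * Θ₂ x ∂μ₂)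
    {G₁ : Type} [Group G₁] [TopologicalSpace G₁] [IsTopologicalGroup G₁] [MeasurableSpace (((UnitaryGroup.cmDatum L 2 J).Local v) × G₁)]
    (χ₁ : G₁ → ℂ) (hχ₁ : Continuous χ₁)
    (DG₂ : (UnitaryGroup.cmDatum L 2 J).Local v → ℝ)
    (hDG₂0 : ∀ γ : (UnitaryGroup.cmDatum L 2 J).Local v, ¬ IsUnit ((γ.val.val.charpoly).discr) → DG₂ γ = 0)
    (hDG₂rel : ∀ (γ : (UnitaryGroup.cmDatum L 2 J).Local v) (u : (UnitaryGroup.LocalRing L v)ˣ),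
      (u : UnitaryGroup.LocalRing L v) * (γ.val.val.det) ^ (2 - 1) = (γ.val.val.charpoly).discr →
        DG₂ γ = ((NNReal.sqrt (NNReal.sqrt (unitModulusChar (UnitaryGroup.LocalRing L v) u)) : ℝ≥0) : ℝ))
    (𝔇 : EllipticData G (((UnitaryGroup.cmDatum L 2 J).Local v) × G₁)) (πSt : IrrClass (((UnitaryGroup.cmDatum L 2 J).Local v) × G₁))
    (hDHf : ∀ h, 𝔇.DH h = DG₂ h.1) (hcharSt : ∀ h, 𝔇.charH πSt h = Θ₂ h.1 * χ₁ h.2)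
    (hSq : 𝔇.sqPacketsH = {({πSt} : Finset (IrrClass (((UnitaryGroup.cmDatum L 2 J).Local v) × G₁)))})
    (P : ((UnitaryGroup.cmDatum L 2 J).Local v) × G₁ → Prop) :
    ∀ ρ ∈ 𝔇.sqPacketsH, ∀ C : Set (((UnitaryGroup.cmDatum L 2 J).Local v) × G₁), IsCompact C →
      ∃ B : ℝ, ∀ s ∈ C, P s → ‖(𝔇.DH s : ℂ) * 𝔇.packetCharH ρ s‖ ≤ B :=
  F0P3cStCharTSHcbH.hHBH_of_compactBound 𝔇 πSt hSq
    (compactBound_charH_of_boxChar L v hHC hns J hJ hJd μ₂ σ₂ Θ₂ hli hlc htr χ₁ hχ₁ DG₂ hDG₂0 hDG₂rel 𝔇 πSt hDHf hcharSt) P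

/-- **S12a's `hHBH` as a theorem of the field equations** (+ `hSq`). [cite: Rogawski1990, §12.5 p. 184; §1.6 p. 6] [cite: HarishChandra1999AdmissibleDistributions, Part III §16 Thm. 16.3] -/
theorem hHBH_cartanH_of_boxChar (hHC : normalizedCharacter_locallyBoundedLeThree)
    (hns : ∀ w : PlacesOver L v, IsCMField.complexConj L • w.1 = w.1)
    (J : Matrix (Fin 2) (Fin 2) L) (hJ : (J.map (cmConjRingHom L))ᵀ = J) (hJd : J.det ≠ 0)
    [MeasurableSpace ((UnitaryGroup.cmDatum L 2 J).Local v)] [BorelSpace ((UnitaryGroup.cmDatum L 2 J).Local v)]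
    (μ₂ : Measure ((UnitaryGroup.cmDatum L 2 J).Local v)) [μ₂.IsHaarMeasure]
    (σ₂ : IrrClass ((UnitaryGroup.cmDatum L 2 J).Local v)) (Θ₂ : (UnitaryGroup.cmDatum L 2 J).Local v → ℂ)
    (hli : LocallyIntegrable Θ₂ μ₂)
    (hlc : ∀ x : (UnitaryGroup.cmDatum L 2 J).Local v, IsRegularElt (x.val : GL (Fin 2) (UnitaryGroup.LocalRing L v)) → ∀ᶠ y in 𝓝 x, Θ₂ y = Θ₂ x)
    (htr : ∀ φ : (UnitaryGroup.cmDatum L 2 J).Local v → ℂ, IsLocSmooth φ → σ₂.smoothTrace μ₂ φ = ∫ x, φ x * Θ₂ x ∂μ₂)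
    {G₁ : Type} [Group G₁] [TopologicalSpace G₁] [IsTopologicalGroup G₁] [MeasurableSpace (((UnitaryGroup.cmDatum L 2 J).Local v) × G₁)]
    (χ₁ : G₁ → ℂ) (hχ₁ : Continuous χ₁)
    (DG₂ : (UnitaryGroup.cmDatum L 2 J).Local v → ℝ)
    (hDG₂0 : ∀ γ : (UnitaryGroup.cmDatum L 2 J).Local v, ¬ IsUnit ((γ.val.val.charpoly).discr) → DG₂ γ = 0)
    (hDG₂rel : ∀ (γ : (UnitaryGroup.cmDatum L 2 J).Local v) (u : (UnitaryGroup.LocalRing L v)ˣ),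
      (u : UnitaryGroup.LocalRing L v) * (γ.val.val.det) ^ (2 - 1) = (γ.val.val.charpoly).discr →
        DG₂ γ = ((NNReal.sqrt (NNReal.sqrt (unitModulusChar (UnitaryGroup.LocalRing L v) u)) : ℝ≥0) : ℝ))
    (𝔇 : EllipticData G (((UnitaryGroup.cmDatum L 2 J).Local v) × G₁)) (πSt : IrrClass (((UnitaryGroup.cmDatum L 2 J).Local v) × G₁))
    (hDHf : ∀ h, 𝔇.DH h = DG₂ h.1) (hcharSt : ∀ h, 𝔇.charH πSt h = Θ₂ h.1 * χ₁ h.2)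
    (hSq : 𝔇.sqPacketsH = {({πSt} : Finset (IrrClass (((UnitaryGroup.cmDatum L 2 J).Local v) × G₁)))}) :
    ∀ ρ ∈ 𝔇.sqPacketsH, ∀ T ∈ 𝔇.cartanH, ∀ C : Set (((UnitaryGroup.cmDatum L 2 J).Local v) × G₁), IsCompact C → C ⊆ (T : Set (((UnitaryGroup.cmDatum L 2 J).Local v) × G₁)) →
      ∃ B : ℝ, ∀ γ ∈ C, ‖(𝔇.DH γ : ℂ) * 𝔇.packetCharH ρ γ‖ ≤ B :=
  F0P3cStCharTSHcbH.hHBH_cartanH_of_compactBound 𝔇 πSt hSq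
    (compactBound_charH_of_boxChar L v hHC hns J hJ hJd μ₂ σ₂ Θ₂ hli hlc htr χ₁ hχ₁ DG₂ hDG₂0 hDG₂rel 𝔇 πSt hDHf hcharSt)

end Datum

end Summit.HodgeConjecture.HodgeConjecture.Cruxes.H413.K2E3HcbHLeThree

end
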